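import Mathlib
import Summits.KontsevichZagierPeriods.KontsevichZagierPeriods.Theorems.InverseLandauTateFamilyKernelStubExactDescent

/-!
# Crux `TateFamilyKernel` (stmt-KontsevichZagierPeriods-9130), line `Sketch` — stub `stub_exactDescentLocal`

The LOCAL form of `stub_exactDescent` (file `InverseLandauTateFamilyKernelStubExactDescent.lean`):
the parameter ranges over an arbitrary interval `(a, b) ∋ ϖ₀` instead of `(0, ε)`, and no Tate
normalisation of the boundary denominator is required. It is the same instantiation of the
abstract exact descent `tame_exactDescent` with the slices `G_k = A_k/D_k(·, ϖ₀)`, their partial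
derivatives (quotient rule) and `u = P_b/Q_b(·, ϖ₀)`, whose tame cube representations are
relations by the local induction hypothesis. No named fact, no new definition.
References: Kontsevich–Zagier 2001 §1.2; Ayoub, EMS Newsl. 91 (2014), Def. 10.
-/

noncomputable section

open MeasureTheory Set MvPolynomial
open Literature.NumberTheory.Transcendental
open Literature.ModelTheory.ExponentialFields (IsSemialgebraic)

namespace Summit.KontsevichZagierPeriods.InverseLandau.TateFamilyKernel.Descent

/-- STUB `stub_exactDescentLocal` of the lead's skeleton (LOCAL exact descent: the exact part is a
relation, given the local crux one dimension down). With the local tame-fibre crux in dimension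
`N + 1` as hypothesis `IH`, Griffiths data `A_k/D_k` regular on the closed cube at a real-algebraic
`ϖ₀ ∈ (a,b)`, and a family `P_b/Q_b` of dimension `N + 1`, `Q_b ≠ 0` on `[0,1]^{N+1} × (a,b)`, with
vanishing open-cube integrals on `(a,b)`, whose fibre at `ϖ₀` is the summed face differences of the
`A_k/D_k`, every tame cube representation of the exact form `Σ_k ∂_{i_k}(A_k/D_k)(·, ϖ₀)` is a
relation (`tame_exactDescent`: Ayoub elements + coordinate permutations + the lift of the fibre of
`P_b/Q_b`, a relation by `IH`). [cite: KontsevichZagier2001, §1.2] [cite: Ayoub2014, Def. 10] -/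
theorem stub_exactDescentLocal (N : ℕ)
    (IH : ∀ (P Q : MvPolynomial (Fin (N + 1 + 1)) ℚ) (a b : ℝ),
      (∀ (z : Fin (N + 1) → ℝ) (ϖ : ℝ), (∀ t, z t ∈ Icc (0 : ℝ) 1) → ϖ ∈ Ioo a b →
        aeval (Fin.snoc z ϖ : Fin (N + 1 + 1) → ℝ) Q ≠ 0) →
      (∀ ϖ ∈ Ioo a b, ∫ z in Set.pi Set.univ (fun _ : Fin (N + 1) => Ioo (0 : ℝ) 1),
        aeval (Fin.snoc z ϖ : Fin (N + 1 + 1) → ℝ) P / aeval (Fin.snoc z ϖ : Fin (N + 1 + 1) → ℝ) Q = 0) →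
      ∀ ϖ₀ : ℝ, IsAlgebraic ℚ ϖ₀ → ϖ₀ ∈ Ioo a b →
      ∀ Φ : KZ.IntegralRep (N + 1), Φ.IsTameCube →
        (∀ z ∈ KZ.cube (N + 1), Φ.integrand z =
          aeval (Fin.snoc z ϖ₀ : Fin (N + 1 + 1) → ℝ) P / aeval (Fin.snoc z ϖ₀ : Fin (N + 1 + 1) → ℝ) Q) →
        KZ.of Φ ∈ KZ.relations)
    (K : ℕ) (i : Fin K → Fin (N + 2)) (A Dn : Fin K → MvPolynomial (Fin (N + 2 + 1)) ℚ)
    (a b ϖ₀ : ℝ) (halg : IsAlgebraic ℚ ϖ₀) (hϖ₀ : ϖ₀ ∈ Ioo a b)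
    (hDn : ∀ k, ∀ w ∈ KZ.cube (N + 2), aeval (Fin.snoc w ϖ₀ : Fin (N + 2 + 1) → ℝ) (Dn k) ≠ 0)
    (Pb Qb : MvPolynomial (Fin (N + 1 + 1)) ℚ)
    (hbadm : ∀ (x : Fin (N + 1) → ℝ) (ϖ : ℝ), (∀ t, x t ∈ Icc (0 : ℝ) 1) → ϖ ∈ Ioo a b →
      aeval (Fin.snoc x ϖ : Fin (N + 1 + 1) → ℝ) Qb ≠ 0)
    (hbval : ∀ x ∈ KZ.cube (N + 1),
      aeval (Fin.snoc x ϖ₀ : Fin (N + 1 + 1) → ℝ) Pb / aeval (Fin.snoc x ϖ₀ : Fin (N + 1 + 1) → ℝ) Qb =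
        ∑ k, (aeval (Fin.snoc (Fin.insertNth (i k) 1 x) ϖ₀ : Fin (N + 2 + 1) → ℝ) (A k) /
              aeval (Fin.snoc (Fin.insertNth (i k) 1 x) ϖ₀ : Fin (N + 2 + 1) → ℝ) (Dn k) -
            aeval (Fin.snoc (Fin.insertNth (i k) 0 x) ϖ₀ : Fin (N + 2 + 1) → ℝ) (A k) /
              aeval (Fin.snoc (Fin.insertNth (i k) 0 x) ϖ₀ : Fin (N + 2 + 1) → ℝ) (Dn k)))
    (hbvan : ∀ ϖ ∈ Ioo a b, ∫ x in Set.pi Set.univ (fun _ : Fin (N + 1) => Ioo (0 : ℝ) 1),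
      aeval (Fin.snoc x ϖ : Fin (N + 1 + 1) → ℝ) Pb / aeval (Fin.snoc x ϖ : Fin (N + 1 + 1) → ℝ) Qb = 0) :
    ∀ R : KZ.IntegralRep (N + 2), R.IsTameCube →
      (∀ w ∈ KZ.cube (N + 2), R.integrand w =
        ∑ k, aeval (Fin.snoc w ϖ₀ : Fin (N + 2 + 1) → ℝ)
            (pderiv (Fin.castSucc (i k)) (A k) * Dn k - A k * pderiv (Fin.castSucc (i k)) (Dn k)) /
          aeval (Fin.snoc w ϖ₀ : Fin (N + 2 + 1) → ℝ) (Dn k ^ 2)) →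
      KZ.of R ∈ KZ.relations := by
  intro R hR hRi
  -- the boundary family is pole-free on the closed cube at `ϖ₀`
  have hQb : ∀ x ∈ KZ.cube (N + 1), aeval (Fin.snoc x ϖ₀ : Fin (N + 1 + 1) → ℝ) Qb ≠ 0 :=
    fun x hx => hbadm x ϖ₀ (fun t => KZ.mem_cube.1 hx t) hϖ₀
  have hD2 : ∀ k, ∀ w ∈ KZ.cube (N + 2),
      aeval (Fin.snoc w ϖ₀ : Fin (N + 2 + 1) → ℝ) (Dn k ^ 2) ≠ 0 := fun k w hw => by
    rw [map_pow]; exact pow_ne_zero 2 (hDn k w hw)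
  exact tame_exactDescent i
    (G := fun k w => aeval (Fin.snoc w ϖ₀ : Fin (N + 2 + 1) → ℝ) (A k) /
      aeval (Fin.snoc w ϖ₀ : Fin (N + 2 + 1) → ℝ) (Dn k))
    (G' := fun k w => aeval (Fin.snoc w ϖ₀ : Fin (N + 2 + 1) → ℝ)
        (pderiv (Fin.castSucc (i k)) (A k) * Dn k - A k * pderiv (Fin.castSucc (i k)) (Dn k)) /
      aeval (Fin.snoc w ϖ₀ : Fin (N + 2 + 1) → ℝ) (Dn k ^ 2))
    (fun k => analyticOnNhd_slice (A k) (Dn k) ϖ₀ (hDn k))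
    (fun k => isSemialgebraicFunOn_slice (A k) (Dn k) halg (hDn k))
    (fun k => analyticOnNhd_slice _ _ ϖ₀ (hD2 k))
    (fun k => isSemialgebraicFunOn_slice _ _ halg (hD2 k))
    (fun k w hw => hasDerivAt_slice_update (A k) (Dn k) ϖ₀ (i k) w (hDn k w hw))
    (analyticOnNhd_slice Pb Qb ϖ₀ hQb) (isSemialgebraicFunOn_slice Pb Qb halg hQb)
    (fun Φ hΦ hΦi => IH Pb Qb a b hbadm hbvan ϖ₀ halg hϖ₀ Φ hΦ hΦi)
    (fun x hx => hbval x hx) R hR hRi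

end Summit.KontsevichZagierPeriods.InverseLandau.TateFamilyKernel.Descent

end
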